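import Summits.RiemannHypothesis.RiemannHypothesis.Theses.LiDirichletEcho
import Summits.RiemannHypothesis.RiemannHypothesis.Theorems.LiPrimeEchoWindowContour
import Literature.NumberTheory.LFunctions.DirichletLZeroCounting
import HarnessLib

/-!
# RiemannHypothesis / LiDirichletEcho — crux K1χ `LiWindowContourChar`: Bombieri's rectangle for `F_n · ξ'/ξ(·, χ)`
# (RH-FREE, GRH-FREE)

RH-FREE · GRH-FREE [rh-li-eng g5, acting as prover on the unstaffed route].  Route `Theses/LiDirichletEcho.lean` (rung
«Li PRIME-ECHO LAW FOR DIRICHLET CHARACTERS» `LiTheory.LiZeroWindowEchoDirichlet`, L-P(P1χ); cell `pub/rh-li`, dossier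
`theory/route/p5`), item `LiWindowContourChar` (stmt-RiemannHypothesis-19399): for a primitive character `χ` mod `q > 1`
and good heights `1 ≤ T₁ < T₂` (no zero of `ξ(·, χ)` on `[−1/2, 3/2] × {T_i}`),

  `2 · charUpperTraceWindow χ n T₁ T₂ = charGammaEdge χ n T₁ T₂ − charPrimeEdge χ n T₁ T₂ + charHorizTerm χ n T₁ − charHorizTerm χ n T₂`.

Proof (the ζ template `Theorems/LiPrimeEchoWindowContour.lean` of the CLOSED route LiPrimeEcho, with the tree's character
inputs of `Literature/NumberTheory/LFunctions/DirichletLZeroCounting.lean`, MV Thm 14.5): the weighted argument principle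
(`Literature.Analysis.Complex.integral_boundary_rect_logDeriv_mul`) on `[−1/2, 3/2] × [T₁, T₂]` for the ENTIRE `ξ(·, χ) =
dirichletXi χ` (`q^{(s+a)/2}·Λ(χ, s)`; no polar edge) and the weight `F_n(s) = (1 − 1/s)ⁿ`; the residues are the window's
non-trivial zeros of `L(s, χ)` at ANY real part with multiplicity `DirichletDisc.zeroOrder`
(`setOf`/`untop₀_meromorphicOrderAt_dirichletXi`), i.e. the UPPER window trace (`Im ρ > T₁ ≥ 1`); the left edge
`Re w = −1/2` is folded onto `Re w = 3/2` by `ξ'/ξ(1 − w̄, χ) = −conj ξ'/ξ(w, χ)` (`logDeriv_dirichletXi_one_sub_conj`: the `χ̄`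
of the functional equation and the `χ̄` of conjugation cancel), producing `k_n = F_n(w) + F_n(1 − w)` and `2 Re Σ`; on
`Re w = 3/2`, `ξ'/ξ(w, χ) = ½ log(q/π) + ½ψ((w+a)/2) − L(χΛ, w)` (`logDeriv_dirichletXi_eq`, `logDeriv_Gammaℝ`, Mathlib's
`LSeries_twist_vonMangoldt_eq`) splits the right edge into the gamma and prime pieces.  The identity holds whatever the
real parts of the zeros are; nothing here bears on the truth of RH or GRH.
-/

noncomputable section

-- D-0017: `Summit.<S>.<S>.…` is the designed namespace of a single-problem summit.
set_option linter.dupNamespace false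

open Complex MeasureTheory intervalIntegral Set
open scoped Real Interval ComplexConjugate ArithmeticFunction.vonMangoldt

namespace Summit.RiemannHypothesis.RiemannHypothesis.Theorems.LiTheory

open Literature.NumberTheory.LFunctions Literature.NumberTheory.LFunctions.DirichletTheta
  Literature.NumberTheory.LFunctions.ExplicitPsiChar

namespace WindowContourChar

open WindowContour

variable {q : ℕ} [NeZero q] {χ : DirichletCharacter ℂ q}

/-! ### The residues are the window zeros of `L(s, χ)`, at any real part -/

/-- At a good height `T` no non-trivial zero of `L(s, χ)` has ordinate `T` (primitive `χ ≠ 1`). -/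
theorem im_ne_of_goodHeight (hχ : χ.IsPrimitive) (h1 : χ ≠ 1) {T : ℝ} (hT : T ∈ charGoodHeights χ) :
    ∀ ρ ∈ charNontrivialZeros χ, ρ.im ≠ T := by
  intro ρ hρ h
  obtain ⟨-, h0, h1'⟩ := mem_charNontrivialZeros.1 hρ
  have hξ : dirichletXi χ ρ = 0 := (dirichletXi_eq_zero_iff_mem_charNontrivialZeros hχ h1 ρ).2 hρ
  have := hT ρ.re ⟨by linarith, by linarith⟩
  rw [← h, Complex.re_add_im] at this
  exact this hξ

/-- The zeros of `ξ(·, χ)` in the open rectangle `(−1/2, 3/2) × (T₁, T₂)` are the non-trivial zeros of `L(s, χ)` with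
`T₁ < Im ρ < T₂` (primitive `χ ≠ 1`). -/
theorem zeroSet_eq (hχ : χ.IsPrimitive) (h1 : χ ≠ 1) (T₁ T₂ : ℝ) :
    {ρ : ℂ | dirichletXi χ ρ = 0 ∧ ρ ∈ Ioo (-(1 / 2) : ℝ) (3 / 2) ×ℂ Ioo T₁ T₂} =
      {ρ : ℂ | ρ ∈ charNontrivialZeros χ ∧ T₁ < ρ.im ∧ ρ.im < T₂} := by
  ext ρ
  simp only [mem_setOf_eq, mem_reProdIm, mem_Ioo, dirichletXi_eq_zero_iff_mem_charNontrivialZeros hχ h1]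
  constructor
  · rintro ⟨h, ⟨-, -⟩, h3, h4⟩; exact ⟨h, h3, h4⟩
  · rintro ⟨h, h3, h4⟩
    have h' := mem_charNontrivialZeros.1 h
    exact ⟨h, ⟨by linarith [h'.2.1], by linarith [h'.2.2]⟩, h3, h4⟩

/-- The window set is finite (`χ ≠ 1`). -/
theorem window_finite (h1 : χ ≠ 1) (T₁ T₂ : ℝ) :
    {ρ : ℂ | ρ ∈ charNontrivialZeros χ ∧ T₁ < ρ.im ∧ ρ.im < T₂}.Finite := by
  refine (lfunctionZeroBox_finite h1 (max |T₁| |T₂|)).subset ?_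
  rintro ρ ⟨hρ, h3, h4⟩
  obtain ⟨hL, h0, h1'⟩ := mem_charNontrivialZeros.1 hρ
  refine mem_lfunctionZeroBox.2 ⟨hL, h0, h1', ?_⟩
  rw [abs_le]
  constructor
  · have : -|T₁| ≤ T₁ := neg_abs_le T₁
    linarith [le_max_left |T₁| |T₂|]
  · linarith [le_abs_self T₂, le_max_right |T₁| |T₂|]

/-- The residue sum is the window's Li sum over the zeros of `L(s, χ)`:
`Σᶠ_{ξ(ρ,χ)=0, ρ ∈ rect°} m_ξ(ρ) F_n(ρ) = Σᶠ_{T₁ < Im ρ < T₂} m(ρ)(1 − 1/ρ)ⁿ`. -/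
theorem residueSum_eq (hχ : χ.IsPrimitive) (h1 : χ ≠ 1) (n : ℕ) (T₁ T₂ : ℝ) :
    (∑ᶠ ρ ∈ {ρ : ℂ | dirichletXi χ ρ = 0 ∧ ρ ∈ Ioo (-(1 / 2) : ℝ) (3 / 2) ×ℂ Ioo T₁ T₂},
        ((meromorphicOrderAt (dirichletXi χ) ρ).untop₀ : ℂ) * liWeight n ρ) =
      ∑ᶠ ρ ∈ {ρ : ℂ | ρ ∈ charNontrivialZeros χ ∧ T₁ < ρ.im ∧ ρ.im < T₂},
        (DirichletDisc.zeroOrder χ ρ : ℂ) * (1 - 1 / ρ) ^ n := by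
  rw [zeroSet_eq hχ h1]
  refine finsum_mem_congr rfl ?_
  rintro ρ ⟨hρ, -, -⟩
  rw [untop₀_meromorphicOrderAt_dirichletXi h1 (mem_charNontrivialZeros.1 hρ).2.1]
  norm_cast

/-- At a good height `T₂` and `0 ≤ T₁ ≤ T₂`, the windowed UPPER trace is the real part of the window's Li sum
`Σᶠ_{T₁ < Im ρ < T₂} m(ρ)(1 − 1/ρ)ⁿ`. -/
theorem charUpperTraceWindow_eq_re (hχ : χ.IsPrimitive) (h1 : χ ≠ 1) (n : ℕ) {T₁ T₂ : ℝ} (hT₁ : 0 ≤ T₁)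
    (hT : T₁ ≤ T₂) (hgood : T₂ ∈ charGoodHeights χ) :
    charUpperTraceWindow χ n T₁ T₂ =
      (∑ᶠ ρ ∈ {ρ : ℂ | ρ ∈ charNontrivialZeros χ ∧ T₁ < ρ.im ∧ ρ.im < T₂},
        (DirichletDisc.zeroOrder χ ρ : ℂ) * (1 - 1 / ρ) ^ n).re := by
  have hne := im_ne_of_goodHeight hχ h1 hgood
  set S₁ : Set ℂ := lfunctionZeroBox χ T₁ ∩ {ρ : ℂ | 0 < ρ.im} with hS₁
  set W : Set ℂ := {ρ : ℂ | ρ ∈ charNontrivialZeros χ ∧ T₁ < ρ.im ∧ ρ.im < T₂} with hW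
  have hS₁f : S₁.Finite := (lfunctionZeroBox_finite h1 T₁).subset inter_subset_left
  have hWf : W.Finite := window_finite h1 T₁ T₂
  have hunion : lfunctionZeroBox χ T₂ ∩ {ρ : ℂ | 0 < ρ.im} = S₁ ∪ W := by
    ext ρ
    simp only [hS₁, hW, mem_inter_iff, mem_union, mem_setOf_eq, mem_lfunctionZeroBox, mem_charNontrivialZeros]
    constructor
    · rintro ⟨⟨hL, h0, h1', habs⟩, him⟩
      by_cases hle : ρ.im ≤ T₁
      · exact Or.inl ⟨⟨hL, h0, h1', abs_le.2 ⟨by linarith, hle⟩⟩, him⟩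
      · refine Or.inr ⟨⟨hL, h0, h1'⟩, lt_of_not_ge hle, lt_of_le_of_ne (abs_le.1 habs).2 ?_⟩
        exact hne ρ (mem_charNontrivialZeros.2 ⟨hL, h0, h1'⟩)
    · rintro (⟨⟨hL, h0, h1', habs⟩, him⟩ | ⟨⟨hL, h0, h1'⟩, h3, h4⟩)
      · exact ⟨⟨hL, h0, h1', (abs_le.2 ⟨by linarith [(abs_le.1 habs).1], by linarith [(abs_le.1 habs).2]⟩)⟩, him⟩
      · exact ⟨⟨hL, h0, h1', abs_le.2 ⟨by linarith, h4.le⟩⟩, by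
          show 0 < ρ.im
          linarith⟩
  have hdisj : Disjoint S₁ W := by
    rw [Set.disjoint_left]
    rintro ρ ⟨hρ, -⟩ ⟨-, h3, -⟩
    have := (abs_le.1 (mem_lfunctionZeroBox.1 hρ).2.2.2).2
    linarith
  unfold charUpperTraceWindow charUpperZeroTrace
  rw [hunion, finsum_mem_union hdisj hS₁f hWf, Complex.add_re]
  ring

/-! ### Bombieri's rectangle: the left edge folded -/

/-- `ξ'/ξ(·, χ)` is continuous wherever `ξ(·, χ) ≠ 0` (`χ ≠ 1`). -/
theorem continuousAt_logDeriv_dirichletXi (h1 : χ ≠ 1) {s : ℂ} (hs : dirichletXi χ s ≠ 0) :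
    ContinuousAt (logDeriv (dirichletXi χ)) s := by
  have hd := differentiable_dirichletXi h1
  have hc : Continuous (deriv (dirichletXi χ)) := (hd.contDiff (n := 1)).continuous_deriv le_rfl
  have : logDeriv (dirichletXi χ) = fun z ↦ deriv (dirichletXi χ) z / dirichletXi χ z := by
    funext z; exact logDeriv_apply _ _
  rw [this]
  exact hc.continuousAt.div hd.continuous.continuousAt hs

/-- `ξ'/ξ(·, χ)` is continuous along the right edge `Re w = 3/2` (primitive `χ ≠ 1`). -/
theorem continuous_logDeriv_dirichletXi_rightEdge (hχ : χ.IsPrimitive) (h1 : χ ≠ 1) :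
    Continuous fun y : ℝ ↦ logDeriv (dirichletXi χ) (((3 / 2 : ℝ) : ℂ) + y * I) := by
  have hcw : Continuous fun y : ℝ ↦ (((3 / 2 : ℝ) : ℂ) + y * I) := by fun_prop
  refine continuous_iff_continuousAt.2 fun y ↦ ?_
  exact (continuousAt_logDeriv_dirichletXi h1
    (dirichletXi_ne_zero_of_not_mem_strip hχ h1 (Or.inr (by simp; norm_num)))).comp hcw.continuousAt

/-- **Stub A (the contour identity for `L(s, χ)` with the left edge folded).**  For primitive `χ ≠ 1` and good heights
`1 ≤ T₁ < T₂`: `2 · charUpperTraceWindow χ n T₁ T₂ = charRightEdge χ n T₁ T₂ + charHorizTerm χ n T₁ − charHorizTerm χ n T₂`. -/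
theorem window_contour (hχ : χ.IsPrimitive) (h1 : χ ≠ 1) (n : ℕ) {T₁ T₂ : ℝ} (hT1 : 1 ≤ T₁) (hlt : T₁ < T₂)
    (hg1 : T₁ ∈ charGoodHeights χ) (hg2 : T₂ ∈ charGoodHeights χ) :
    2 * charUpperTraceWindow χ n T₁ T₂ = charRightEdge χ n T₁ T₂ + charHorizTerm χ n T₁ - charHorizTerm χ n T₂ := by
  -- adapted from `WindowContour.window_contour` (Theorems/LiPrimeEchoWindowContour.lean, route LiPrimeEcho)
  have hT₁ : 0 < T₁ := by linarith
  have hπ := Real.pi_pos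
  -- the weighted argument principle
  have key := Literature.Analysis.Complex.integral_boundary_rect_logDeriv_mul (f := dirichletXi χ) (g := liWeight n)
    (a := -(1 / 2)) (b := 3 / 2) (c := T₁) (d := T₂) (by norm_num) hlt
    (fun z _ ↦ (differentiable_dirichletXi h1).analyticAt z)
    (fun z hz ↦ analyticAt_liWeight n (by
      intro h0
      have hz2 := (Complex.mem_reProdIm.1 hz).2
      rw [h0, Complex.zero_im] at hz2
      linarith [hz2.1]))
    (fun x hx ↦ hg1 x hx) (fun x hx ↦ hg2 x hx)
    (fun y _ ↦ dirichletXi_ne_zero_of_not_mem_strip hχ h1 (Or.inl (by simp)))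
    (fun y _ ↦ dirichletXi_ne_zero_of_not_mem_strip hχ h1 (Or.inr (by simp; norm_num)))
  simp only [← logDeriv_apply] at key
  rw [residueSum_eq hχ h1 n T₁ T₂] at key
  -- names for the four edges
  set Z : ℂ := ∑ᶠ ρ ∈ {ρ : ℂ | ρ ∈ charNontrivialZeros χ ∧ T₁ < ρ.im ∧ ρ.im < T₂},
    (DirichletDisc.zeroOrder χ ρ : ℂ) * (1 - 1 / ρ) ^ n with hZ
  set Ibot := ∫ x : ℝ in (-(1 / 2) : ℝ)..(3 / 2), logDeriv (dirichletXi χ) (x + T₁ * I) * liWeight n (x + T₁ * I)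
    with hIbot
  set Itop := ∫ x : ℝ in (-(1 / 2) : ℝ)..(3 / 2), logDeriv (dirichletXi χ) (x + T₂ * I) * liWeight n (x + T₂ * I)
    with hItop
  set IR := ∫ y : ℝ in T₁..T₂, logDeriv (dirichletXi χ) (((3 / 2 : ℝ) : ℂ) + y * I) *
    liWeight n (((3 / 2 : ℝ) : ℂ) + y * I) with hIR
  set IR' := ∫ y : ℝ in T₁..T₂, logDeriv (dirichletXi χ) (((3 / 2 : ℝ) : ℂ) + y * I) *
    liWeight n (1 - (((3 / 2 : ℝ) : ℂ) + y * I)) with hIR'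
  set IL := ∫ y : ℝ in T₁..T₂, logDeriv (dirichletXi χ) (((-(1 / 2) : ℝ) : ℂ) + y * I) *
    liWeight n (((-(1 / 2) : ℝ) : ℂ) + y * I) with hIL
  -- `key : Ibot − Itop + I IR − I IL = 2πi Z`
  -- fold the left edge: its integrand is `−conj(ξ'/ξ(w, χ) F_n(1 − w))`, `w = 3/2 + iy`
  have hfold : IL = -conj IR' := by
    have e : ∀ y : ℝ, logDeriv (dirichletXi χ) (((-(1 / 2) : ℝ) : ℂ) + y * I) *
        liWeight n (((-(1 / 2) : ℝ) : ℂ) + y * I) =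
        -conj (logDeriv (dirichletXi χ) (((3 / 2 : ℝ) : ℂ) + y * I) *
          liWeight n (1 - (((3 / 2 : ℝ) : ℂ) + y * I))) := by
      intro y
      have h1' : (((-(1 / 2) : ℝ) : ℂ) + y * I) = 1 - conj (((3 / 2 : ℝ) : ℂ) + y * I) := by
        apply Complex.ext
        · simp only [Complex.add_re, Complex.ofReal_re, Complex.mul_re, Complex.I_re, Complex.ofReal_im,
            Complex.I_im, Complex.sub_re, Complex.one_re, Complex.conj_re]
          norm_num
        · simp only [Complex.add_im, Complex.ofReal_re, Complex.mul_im, Complex.I_re, Complex.ofReal_im,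
            Complex.I_im, Complex.sub_im, Complex.one_im, Complex.conj_im]
          norm_num
      have h2 : (((-(1 / 2) : ℝ) : ℂ) + y * I) = conj (1 - (((3 / 2 : ℝ) : ℂ) + y * I)) := by
        rw [h1', map_sub, map_one]
      have hxi : logDeriv (dirichletXi χ) (1 - conj (((3 / 2 : ℝ) : ℂ) + y * I)) =
          -conj (logDeriv (dirichletXi χ) (((3 / 2 : ℝ) : ℂ) + y * I)) := by
        rw [logDeriv_apply, logDeriv_apply]
        exact logDeriv_dirichletXi_one_sub_conj hχ h1 _
      conv_lhs => rw [h1']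
      rw [hxi, ← h1', h2, liWeight_conj, map_mul]
      ring
    rw [hIL, intervalIntegral.integral_congr (fun y _ ↦ e y), intervalIntegral.integral_neg,
      intervalIntegral.integral_of_le hlt.le, integral_conj, ← intervalIntegral.integral_of_le hlt.le]
  -- real parts: `Re Z = (Im ∮)/(2π)`
  have hZre : charUpperTraceWindow χ n T₁ T₂ = Z.re := charUpperTraceWindow_eq_re hχ h1 n hT₁.le hlt.le hg2
  have h2Zre : 2 * Z.re = 1 / Real.pi * (Ibot.im - Itop.im + IR.re - IL.re) := by
    have hIm := congrArg Complex.im key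
    simp only [Complex.sub_im, Complex.add_im, Complex.mul_im, Complex.I_re, Complex.I_im, Complex.mul_re,
      Complex.ofReal_re, Complex.ofReal_im, Complex.re_ofNat, Complex.im_ofNat, zero_mul, one_mul, mul_zero,
      mul_one, zero_add, add_zero, sub_zero] at hIm
    field_simp
    linarith
  have hILre : IL.re = -IR'.re := by rw [hfold, Complex.neg_re, Complex.conj_re]
  -- the right edge is `IR + IR'`
  have hc : Continuous fun y : ℝ ↦ logDeriv (dirichletXi χ) (((3 / 2 : ℝ) : ℂ) + y * I) :=
    continuous_logDeriv_dirichletXi_rightEdge hχ h1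
  have hw0 : ∀ y : ℝ, (((3 / 2 : ℝ) : ℂ) + y * I) ≠ 0 := fun y h ↦ by
    have := congrArg Complex.re h; norm_num at this
  have hw1 : ∀ y : ℝ, 1 - (((3 / 2 : ℝ) : ℂ) + y * I) ≠ 0 := fun y h ↦ by
    have := congrArg Complex.re h; norm_num at this
  have hcw : Continuous fun y : ℝ ↦ (((3 / 2 : ℝ) : ℂ) + y * I) := by fun_prop
  have hcw' : Continuous fun y : ℝ ↦ 1 - (((3 / 2 : ℝ) : ℂ) + y * I) := by fun_prop
  have hcF : Continuous fun y : ℝ ↦ liWeight n (((3 / 2 : ℝ) : ℂ) + y * I) := by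
    refine continuous_iff_continuousAt.2 fun y ↦ ?_
    show ContinuousAt ((liWeight n) ∘ fun y : ℝ ↦ (((3 / 2 : ℝ) : ℂ) + y * I)) y
    exact ContinuousAt.comp (analyticAt_liWeight n (hw0 y)).continuousAt hcw.continuousAt
  have hcF' : Continuous fun y : ℝ ↦ liWeight n (1 - (((3 / 2 : ℝ) : ℂ) + y * I)) := by
    refine continuous_iff_continuousAt.2 fun y ↦ ?_
    show ContinuousAt ((liWeight n) ∘ fun y : ℝ ↦ 1 - (((3 / 2 : ℝ) : ℂ) + y * I)) y
    exact ContinuousAt.comp (analyticAt_liWeight n (hw1 y)).continuousAt hcw'.continuousAt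
  have i1 : IntervalIntegrable (fun y : ℝ ↦ logDeriv (dirichletXi χ) (((3 / 2 : ℝ) : ℂ) + y * I) *
      liWeight n (((3 / 2 : ℝ) : ℂ) + y * I)) volume T₁ T₂ := (hc.mul hcF).intervalIntegrable _ _
  have i2 : IntervalIntegrable (fun y : ℝ ↦ logDeriv (dirichletXi χ) (((3 / 2 : ℝ) : ℂ) + y * I) *
      liWeight n (1 - (((3 / 2 : ℝ) : ℂ) + y * I))) volume T₁ T₂ := (hc.mul hcF').intervalIntegrable _ _
  have hright : charRightEdge χ n T₁ T₂ = 1 / Real.pi * (IR + IR').re := by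
    unfold charRightEdge
    rw [hIR, hIR', ← intervalIntegral.integral_add i1 i2]
    congr 2
    refine intervalIntegral.integral_congr fun y _ ↦ ?_
    rw [liRightPt_eq, liSymWeight]
    ring
  have hbot : charHorizTerm χ n T₁ = 1 / Real.pi * Ibot.im := rfl
  have htop : charHorizTerm χ n T₂ = 1 / Real.pi * Itop.im := rfl
  rw [hZre, h2Zre, hright, hbot, htop, hILre, Complex.add_re]
  ring

/-! ### The right edge splits -/

/-- On `Re w = 3/2`: `ξ'/ξ(w, χ) = ½ log(q/π) + ½ ψ((w + a)/2) − L(χΛ, w)` (`χ ≠ 1`; no polar term). -/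
theorem logDeriv_dirichletXi_rightPt (h1 : χ ≠ 1) (y : ℝ) :
    logDeriv (dirichletXi χ) (liRightPt y) =
      (Real.log (q / Real.pi) : ℂ) / 2 + 1 / 2 * Complex.digamma ((liRightPt y + (charParity χ : ℂ)) / 2)
        - LSeries (fun m : ℕ ↦ χ (m : ZMod q) * (Λ m : ℂ)) (liRightPt y) := by
  have hre : (liRightPt y).re = 3 / 2 := by simp [liRightPt]
  have hre0 : 0 < (liRightPt y).re := by rw [hre]; norm_num
  have hre1 : 1 < (liRightPt y).re := by rw [hre]; norm_num
  have hL : χ.LFunction (liRightPt y) ≠ 0 :=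
    DirichletCharacter.LFunction_ne_zero_of_one_le_re χ (Or.inl h1) hre1.le
  have hpole : ∀ m : ℕ, (liRightPt y + (charParity χ : ℂ)) / 2 ≠ -(m : ℂ) := by
    intro m h
    have := congrArg Complex.re h
    simp only [Complex.div_ofNat_re, Complex.add_re, hre, Complex.natCast_re, Complex.neg_re] at this
    have h0 : (0 : ℝ) ≤ charParity χ := Nat.cast_nonneg _
    have hm : (0 : ℝ) ≤ m := Nat.cast_nonneg _
    linarith
  have hΓ := Literature.NumberTheory.LFunctions.logDeriv_Gammaℝ hpole
  -- the `L'/L` piece is `−L(χΛ, w)`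
  have hLL : logDeriv χ.LFunction (liRightPt y) = -LSeries (fun m : ℕ ↦ χ (m : ZMod q) * (Λ m : ℂ)) (liRightPt y) := by
    have htw := DirichletCharacter.LSeries_twist_vonMangoldt_eq χ hre1
    have hf : (fun m : ℕ ↦ χ (m : ZMod q) * (Λ m : ℂ)) = ((fun n : ℕ ↦ χ (n : ZMod q)) * fun n : ℕ ↦ (Λ n : ℂ)) := by
      funext m; simp [Pi.mul_apply]
    rw [hf, htw, logDeriv_apply, DirichletCharacter.deriv_LFunction_eq_deriv_LSeries χ hre1,
      DirichletCharacter.LFunction_eq_LSeries χ hre1, neg_div, neg_neg]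
  have hq0 : (q : ℝ) ≠ 0 := by exact_mod_cast NeZero.ne q
  have hlog : (Real.log (q / Real.pi) : ℂ) = (Real.log q : ℂ) - Complex.log Real.pi := by
    rw [Real.log_div hq0 Real.pi_ne_zero, ← Complex.ofReal_log Real.pi_pos.le]
    push_cast
    ring
  rw [logDeriv_apply, logDeriv_dirichletXi_eq h1 hre0 hL, hΓ, hLL, hlog]
  ring

/-- **Stub B (splitting the right edge of `L(s, χ)`).**  For any `T₁, T₂` and primitive `χ ≠ 1`:
`charRightEdge χ = charGammaEdge χ − charPrimeEdge χ`. -/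
theorem rightEdge_split (hχ : χ.IsPrimitive) (h1 : χ ≠ 1) (n : ℕ) (T₁ T₂ : ℝ) :
    charRightEdge χ n T₁ T₂ = charGammaEdge χ n T₁ T₂ - charPrimeEdge χ n T₁ T₂ := by
  -- adapted from `WindowContour.rightEdge_split` (Theorems/LiPrimeEchoWindowContour.lean, route LiPrimeEcho)
  have hw : ∀ y : ℝ, (liRightPt y).re = 3 / 2 := fun y ↦ by simp [liRightPt]
  have hw0 : ∀ y : ℝ, liRightPt y ≠ 0 := fun y h ↦ by have := hw y; rw [h] at this; norm_num at this
  have hw1 : ∀ y : ℝ, liRightPt y - 1 ≠ 0 := fun y h ↦ by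
    have := congrArg Complex.re h; simp [liRightPt] at this; norm_num at this
  have hw1' : ∀ y : ℝ, 1 - liRightPt y ≠ 0 := fun y h ↦ hw1 y (by rw [← neg_sub, h, neg_zero])
  have hcw : Continuous liRightPt := by unfold liRightPt; fun_prop
  have hcw' : Continuous fun y : ℝ ↦ 1 - liRightPt y := continuous_const.sub hcw
  have hck : Continuous fun y : ℝ ↦ liSymWeight n (liRightPt y) := by
    refine continuous_iff_continuousAt.2 fun y ↦ ?_
    have h1 : ContinuousAt ((liWeight n) ∘ liRightPt) y :=
      ContinuousAt.comp (analyticAt_liWeight n (hw0 y)).continuousAt hcw.continuousAt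
    have h2 : ContinuousAt ((liWeight n) ∘ fun y : ℝ ↦ 1 - liRightPt y) y :=
      ContinuousAt.comp (analyticAt_liWeight n (hw1' y)).continuousAt hcw'.continuousAt
    exact h1.add h2
  have hcxi : Continuous fun y : ℝ ↦ logDeriv (dirichletXi χ) (liRightPt y) := by
    have := continuous_logDeriv_dirichletXi_rightEdge hχ h1
    refine this.congr fun y ↦ ?_
    rw [liRightPt_eq]
  have hcgam : Continuous fun y : ℝ ↦ ((Real.log (q / Real.pi) : ℂ) / 2
      + 1 / 2 * Complex.digamma ((liRightPt y + (charParity χ : ℂ)) / 2)) := by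
    refine continuous_iff_continuousAt.2 fun y ↦ ?_
    have hψ : ContinuousAt (fun y : ℝ ↦ Complex.digamma ((liRightPt y + (charParity χ : ℂ)) / 2)) y := by
      refine (continuousAt_digamma_of_re_pos ?_).comp ((hcw.continuousAt.add continuousAt_const).div_const 2)
      rw [Complex.div_ofNat_re, Complex.add_re, hw y, Complex.natCast_re]
      have h0 : (0 : ℝ) ≤ charParity χ := Nat.cast_nonneg _
      linarith
    exact continuousAt_const.add (continuousAt_const.mul hψ)
  set B : ℝ → ℂ := fun y ↦ ((Real.log (q / Real.pi) : ℂ) / 2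
      + 1 / 2 * Complex.digamma ((liRightPt y + (charParity χ : ℂ)) / 2)) * liSymWeight n (liRightPt y) with hB
  set X : ℝ → ℂ := fun y ↦ logDeriv (dirichletXi χ) (liRightPt y) * liSymWeight n (liRightPt y) with hX
  set C : ℝ → ℂ := fun y ↦ LSeries (fun m : ℕ ↦ χ (m : ZMod q) * (Λ m : ℂ)) (liRightPt y) *
    liSymWeight n (liRightPt y) with hC
  have iB : IntervalIntegrable B volume T₁ T₂ := (hcgam.mul hck).intervalIntegrable _ _
  have iX : IntervalIntegrable X volume T₁ T₂ := (hcxi.mul hck).intervalIntegrable _ _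
  -- pointwise: `X = B − C`
  have hsplit : ∀ y : ℝ, X y = B y - C y := by
    intro y
    simp only [hX, hB, hC]
    rw [logDeriv_dirichletXi_rightPt h1 y]
    ring
  have iC : IntervalIntegrable C volume T₁ T₂ := by
    refine (iB.sub iX).congr fun y _ ↦ ?_
    show B y - X y = C y
    rw [hsplit y]
    ring
  have hint : ∫ y in T₁..T₂, X y = (∫ y in T₁..T₂, B y) - ∫ y in T₁..T₂, C y := by
    rw [← intervalIntegral.integral_sub iB iC]
    exact intervalIntegral.integral_congr fun y _ ↦ hsplit y
  unfold charRightEdge charGammaEdge charPrimeEdge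
  change 1 / Real.pi * (∫ y in T₁..T₂, X y).re =
    1 / Real.pi * (∫ y in T₁..T₂, B y).re - 1 / Real.pi * (∫ y in T₁..T₂, C y).re
  rw [hint, Complex.sub_re]
  ring

end WindowContourChar

open WindowContourChar in
/-- **Crux K1χ `LiWindowContourChar` of route `LiDirichletEcho`** (stmt-RiemannHypothesis-19399; RH-FREE, GRH-FREE): for
primitive `χ` mod `q > 1` at good heights `1 ≤ T₁ < T₂`,
`2 · charUpperTraceWindow χ n T₁ T₂ = charGammaEdge χ n T₁ T₂ − charPrimeEdge χ n T₁ T₂ + charHorizTerm χ n T₁ − charHorizTerm χ n T₂`.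
Verbatim the route statement. -/
theorem liWindowContourChar_eq {q : ℕ} [NeZero q] (χ : DirichletCharacter ℂ q) (hχ : χ.IsPrimitive) (hq : 1 < q) :
    ∀ (n : ℕ) (T₁ T₂ : ℝ), 1 ≤ T₁ → T₁ < T₂ → T₁ ∈ charGoodHeights χ → T₂ ∈ charGoodHeights χ →
      2 * charUpperTraceWindow χ n T₁ T₂ = charGammaEdge χ n T₁ T₂ - charPrimeEdge χ n T₁ T₂ +
        charHorizTerm χ n T₁ - charHorizTerm χ n T₂ := by
  intro n T₁ T₂ hT1 hlt hg1 hg2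
  have h1 : χ ≠ 1 := ne_one_of_isPrimitive hχ hq
  rw [window_contour hχ h1 n hT1 hlt hg1 hg2, rightEdge_split hχ h1 n T₁ T₂]

/-- **Item `LiWindowContourChar` of route `LiDirichletEcho`** (stmt-RiemannHypothesis-19399), closed BY NAME. -/
theorem liWindowContourChar_proof :
    Summit.RiemannHypothesis.RiemannHypothesis.Theses.LiDirichletEcho.LiWindowContourChar :=
  fun _ _ χ hχ hq ↦ liWindowContourChar_eq χ hχ hq

end Summit.RiemannHypothesis.RiemannHypothesis.Theorems.LiTheory

end
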